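import Summits.Ventures.LatticeQCDFlow.Exactness.Phi4MetropolisMagnetisationTunnelling
import Summits.Ventures.LatticeQCDFlow.Exactness.Phi4PhaseLabelFlipRateHMCFlow
import Summits.Ventures.LatticeQCDFlow.Exactness.Phi4HMCPolyObsFloor
import HarnessLib

/-!
# The MAGNETISATION ITSELF inherits the tunnelling-event floor of the HMC arm: `τ_int,traj(M) ≥ ⟨|M|⟩²/(2 Var(M) r_sign) − ½`, every integrator

HONEST FRAMING: exact (Metropolis-corrected) sampling algorithms for lattice gauge theory;
figures of merit are autocorrelation/cost numbers at stated couplings and volumes; no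
continuum-physics claim.  (SCALAR calibration rung S0-A: not a gauge result.)

Venture `LatticeQCDFlow` (cell pub-lqcd), topic `Exactness`; FANOUT row 2 (`s0-phi4`, the HMC
arm).  NEW WORK of the cell: the lattice instance of the variational floor
(`Exactness/ReversibleVariationalFloorThinned.lean`, `RevOp.tauInt_ge_variational_of_le`) for the
HMC-type update `K_Ψ = hmcOpOf J λ Ψ` (refresh `p ∼ N(0,1)^Λ`, propose `Ψ(φ, p)` for ANY
measurable Lebesgue-preserving involution `Ψ` of phase space with polynomial growth — row 2's qpq
leapfrog `hmcProposal J λ δ N` of every step size and length is one — accept with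
`min(1, e^{−ΔH})`) on the polynomial class `PolyObs` (`Phi4HMCPolyObs*`: `K_Ψ` is a reversible
`L²(e^{−S})` contraction there), with a PHASE LABEL `θ = ±1` as trial observable, whose Dirichlet
form is `2 r`, `r` the probability per update of an ACCEPTED label change
(`Phi4PhaseLabelFlipRate.label_sq_sub_eq_four_mul_flip`, `integral_hmcOpOf_sq_dev_eq_poly`).
Nothing is cited as a fact.  Printed counterpart NAMED ONLY: the trial-observable bounds of
Caracciolo–Pelissetto–Sokal 1990 (J. Stat. Phys. 60); counting tunnelling events of `sgn M` / of the
topological charge as a mixing diagnostic is lattice folklore.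

## What is proved (`Λ = Fin (n+1)`, every `λ > 0`, every real `J`; `⟨·⟩` the Gibbs mean; `τ_int`
per update = per trajectory; hypothesis of every floor, NOT discharged for any run: the
autocorrelation series of the observable is summable)

* **`hmc_tauInt_ge_cross`** — CROSS-OBSERVABLE FLOOR, every `Ψ` as above: for every `g ∈ PolyObs`
  and every label `θ` of a measurable `F` at level `c`, with
  `r = ∫∫ a(z) χ_flip((Ψ z).1, z.1) e^{−H(z)} dz/(Z_p Z)`:
  **`τ_int(g) ≥ ⟨g θ⟩² / (⟨g²⟩ · 2 r) − ½`**;  `hmcPhi4_tauInt_ge_cross` — row 2's qpq HMC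
  `hmcOpPhi4 J λ δ N`, every `δ`, `N`.
* **`hmc_tauInt_ge_magnetisation_signFlip`** / **`hmcPhi4_tauInt_ge_magnetisation_signFlip`** —
  `g = M − ⟨M⟩`, `θ = sgn M` (`M sgn M = |M|`, `⟨sgn M⟩ = 0`):
  **`τ_int,traj(M) ≥ ⟨|M|⟩² / (2 Var(M) r_sign) − ½`**, `r_sign` the probability per trajectory of
  an accepted change of the sign of `M`.

Reading (no numerics implied): a run of `T` trajectories showing `F` sign changes of `M` cannot
certify `τ_int(M) < ⟨|M|⟩²/Var(M) · T/(2F) − ½` in equilibrium — gen-16's audit inequality for the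
label now constrains the magnetisation's own `τ_int` column (in the two-peak regime
`⟨|M|⟩² ≈ Var(M)`).  NOT CLAIMED: summability for any run; any value of `r_sign`, `⟨|M|⟩` for a
run; a bottleneck (strip-mass) form for HMC (a trajectory crosses `M = 0` from afar — none is
claimed); partial momentum refreshment; upper bounds.
-/

namespace Summit.Ventures.LatticeQCDFlow.Exactness

open Real MeasureTheory Filter Finset
open Summit.Ventures.LatticeQCDFlow.Scoring

section HMCMagnetisationTunnelling

variable {n : ℕ}

/-- Bookkeeping: `(B/Z)²/((P/Z)(2(I/(Z_p Z)))) = B²/(P(4I/Z_p/2))` (`Z, Z_p ≠ 0`). -/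
theorem hmc_cross_floor_transfer {Z Zp : ℝ} (hZ : Z ≠ 0) (hZp : Zp ≠ 0) (B P I : ℝ) :
    (B / Z) ^ 2 / (P / Z * (2 * (I / (Zp * Z)))) = B ^ 2 / (P * (4 * I / Zp / 2)) := by
  by_cases hI : I = 0
  · simp [hI]
  by_cases hP : P = 0
  · simp [hP]
  field_simp
  ring

/-- **THE CROSS-OBSERVABLE FLOOR OF EVERY HMC-TYPE UPDATE.**  Every `λ > 0`, real `J`, measurable
Lebesgue-preserving involution `Ψ` of phase space with `s(Ψ z) ≤ C s(z)^m`; `g ∈ PolyObs`; `F`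
measurable, `c` a level, `θ = ±1` the label of `{c ≤ F}`;
`r = ∫∫ a(z) χ_flip((Ψ z).1, z.1) e^{−H(z)} dz / (Z_p Z)` the probability per update of an accepted
label change.  If the autocorrelation series of `g` is summable, then
`τ_int(g) ≥ ⟨g θ⟩² / (⟨g²⟩ · 2 r) − ½`. -/
theorem hmc_tauInt_ge_cross {lam : ℝ} (hlam : 0 < lam) (J : Fin (n + 1) → Fin (n + 1) → ℝ)
    {Ψ : (Fin (n + 1) → ℝ) × (Fin (n + 1) → ℝ) → (Fin (n + 1) → ℝ) × (Fin (n + 1) → ℝ)}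
    (hΨm : Measurable Ψ) (hΨi : Function.Involutive Ψ)
    (hΨμ : MeasurePreserving Ψ ((volume : Measure (Fin (n + 1) → ℝ)).prod volume)
      ((volume : Measure (Fin (n + 1) → ℝ)).prod volume))
    {C : ℝ} {m : ℕ} (hC : 0 ≤ C) (hΨg : ∀ z, phaseSize (Ψ z) ≤ C * phaseSize z ^ m)
    {g : (Fin (n + 1) → ℝ) → ℝ} (hg : PolyObs g)
    {F : (Fin (n + 1) → ℝ) → ℝ} (hF : Measurable F) (c : ℝ)
    (hs : Summable fun k => (∫ φ, g φ * ((hmcOpOf J lam Ψ)^[k + 1] g) φ * gibbsWeight J lam φ)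
        / ∫ φ, g φ ^ 2 * gibbsWeight J lam φ) :
    gibbsExpect J lam (fun φ => g φ * (if c ≤ F φ then (1 : ℝ) else -1)) ^ 2
        / (gibbsExpect J lam (fun φ => g φ ^ 2)
          * (2 * ((∫ z, involAccept (phi4HmcEnergy J lam) Ψ z
            * (if (c ≤ F (Ψ z).1 ↔ c ≤ F z.1) then (0 : ℝ) else 1)
            * Real.exp (-phi4HmcEnergy J lam z) ∂((volume : Measure (Fin (n + 1) → ℝ)).prod volume))
          / (momentumZ n * gibbsZ J lam)))) - 1 / 2
      ≤ tauInt (fun k => (∫ φ, g φ * ((hmcOpOf J lam Ψ)^[k] g) φ * gibbsWeight J lam φ)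
        / ∫ φ, g φ ^ 2 * gibbsWeight J lam φ) := by
  have hco := latticePhi4Action_coercive hlam J
  have hZ := gibbsZ_pos hlam J
  have hZp := momentumZ_pos n
  have hθ : PolyObs (fun φ : Fin (n + 1) → ℝ => if c ≤ F φ then (1 : ℝ) else -1) :=
    polyObs_of_bddObs (label_bddObs hF c)
  set I := ∫ z, involAccept (phi4HmcEnergy J lam) Ψ z
      * (if (c ≤ F (Ψ z).1 ↔ c ≤ F z.1) then (0 : ℝ) else 1)
      * Real.exp (-phi4HmcEnergy J lam z) ∂((volume : Measure (Fin (n + 1) → ℝ)).prod volume) with hI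
  -- the integrated carré du champ of the label through phase space is `4 I / Z_p`
  have hΓ : ∫ φ, hmcOpOf J lam Ψ (fun ψ => ((if c ≤ F ψ then (1 : ℝ) else -1)
      - (if c ≤ F φ then (1 : ℝ) else -1)) ^ 2) φ * gibbsWeight J lam φ ≤ 4 * I / momentumZ n := by
    rw [integral_hmcOpOf_sq_dev_eq_poly one_pos hco hΨm hΨμ hθ, hI, ← integral_const_mul]
    refine le_of_eq ?_
    congr 1
    refine integral_congr_ae (Eventually.of_forall fun z => ?_)
    show involAccept (phi4HmcEnergy J lam) Ψ z
        * ((if c ≤ F (Ψ z).1 then (1 : ℝ) else -1) - (if c ≤ F z.1 then (1 : ℝ) else -1)) ^ 2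
        * Real.exp (-phi4HmcEnergy J lam z)
      = 4 * (involAccept (phi4HmcEnergy J lam) Ψ z
        * (if (c ≤ F (Ψ z).1 ↔ c ≤ F z.1) then (0 : ℝ) else 1) * Real.exp (-phi4HmcEnergy J lam z))
    rw [label_sq_sub_eq_four_mul_flip]
    ring
  have hE := RevOp.dirichlet_le_of_integral_carre_le (μ := volume) (A := PolyObs)
    (K := hmcOpOf J lam Ψ) (w := gibbsWeight J lam) (polyObs_const 1)
    (fun f h hf hh => polyObs_integrable_mul_mul_gibbsWeight one_pos hco hf hh)
    (fun f h c hf hh => polyObs_add_mul hf hh c)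
    (fun f hf => polyObs_hmcOpOf J lam hΨm hC hΨg hf)
    (fun f h c hf hh x => hmcOpOf_add_mul_poly J lam hΨm hC hΨg hf hh c x)
    (fun f h hf hh => hmc_reversible_poly one_pos hco hΨm hΨi hΨμ hf hh)
    (fun φ => hmcOpOf_one J lam Ψ φ) hθ (polyObs_sq hθ) hΓ
  have hfloor := RevOp.tauInt_ge_variational_of_le (μ := volume) (A := PolyObs)
    (K := hmcOpOf J lam Ψ) (w := gibbsWeight J lam)
    (fun φ => (gibbsWeight_pos J lam φ).le)
    (fun f h hf hh => polyObs_integrable_mul_mul_gibbsWeight one_pos hco hf hh)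
    (fun f h c hf hh => polyObs_add_mul hf hh c)
    (fun f hf => polyObs_hmcOpOf J lam hΨm hC hΨg hf)
    (fun f h c hf hh x => hmcOpOf_add_mul_poly J lam hΨm hC hΨg hf hh c x)
    (fun f h hf hh => hmc_reversible_poly one_pos hco hΨm hΨi hΨμ hf hh)
    (fun f hf => hmcOpOf_contraction_poly one_pos hco hΨm hΨi hΨμ hC hΨg hf)
    hg hθ hs hE
  unfold gibbsExpect
  rw [hmc_cross_floor_transfer hZ.ne' hZp.ne']
  exact hfloor

/-- **Row 2's HMC** (`hmcOpPhi4 J λ δ N`: qpq leapfrog, every `δ`, `N`): for every `g ∈ PolyObs` and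
every phase label `θ`, `τ_int,traj(g) ≥ ⟨g θ⟩² / (⟨g²⟩ · 2 r) − ½`, `r` the probability per
trajectory of an accepted label change. -/
theorem hmcPhi4_tauInt_ge_cross {lam : ℝ} (hlam : 0 < lam) (J : Fin (n + 1) → Fin (n + 1) → ℝ)
    (δ : ℝ) (N : ℕ) {g : (Fin (n + 1) → ℝ) → ℝ} (hg : PolyObs g)
    {F : (Fin (n + 1) → ℝ) → ℝ} (hF : Measurable F) (c : ℝ)
    (hs : Summable fun k => (∫ φ, g φ * ((hmcOpPhi4 J lam δ N)^[k + 1] g) φ * gibbsWeight J lam φ)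
        / ∫ φ, g φ ^ 2 * gibbsWeight J lam φ) :
    gibbsExpect J lam (fun φ => g φ * (if c ≤ F φ then (1 : ℝ) else -1)) ^ 2
        / (gibbsExpect J lam (fun φ => g φ ^ 2)
          * (2 * ((∫ z, involAccept (phi4HmcEnergy J lam) (hmcProposal J lam δ N) z
            * (if (c ≤ F (hmcProposal J lam δ N z).1 ↔ c ≤ F z.1) then (0 : ℝ) else 1)
            * Real.exp (-phi4HmcEnergy J lam z) ∂((volume : Measure (Fin (n + 1) → ℝ)).prod volume))
          / (momentumZ n * gibbsZ J lam)))) - 1 / 2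
      ≤ tauInt (fun k => (∫ φ, g φ * ((hmcOpPhi4 J lam δ N)^[k] g) φ * gibbsWeight J lam φ)
        / ∫ φ, g φ ^ 2 * gibbsWeight J lam φ) := by
  obtain ⟨C, hC1, hCg⟩ := hmcProposal_growth J lam δ N
  exact hmc_tauInt_ge_cross hlam J (measurable_hmcProposal J lam δ N)
    (hmcProposal_involutive J lam δ N) (measurePreserving_hmcProposal J lam δ N)
    (zero_le_one.trans hC1) hCg hg hF c hs

/-- **THE MAGNETISATION INHERITS THE SIGN-FLIP FLOOR, EVERY HMC-TYPE UPDATE** (`Ψ` as in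
`hmc_tauInt_ge_cross`): `g = M − ⟨M⟩`, `θ = sgn M`; if the autocorrelation series of `M` is summable,
`τ_int(M) ≥ ⟨|M|⟩² / (Var(M) · 2 r_sign) − ½`, `r_sign` the probability per update of an accepted
change of the sign of `M`. -/
theorem hmc_tauInt_ge_magnetisation_signFlip {lam : ℝ} (hlam : 0 < lam)
    (J : Fin (n + 1) → Fin (n + 1) → ℝ)
    {Ψ : (Fin (n + 1) → ℝ) × (Fin (n + 1) → ℝ) → (Fin (n + 1) → ℝ) × (Fin (n + 1) → ℝ)}
    (hΨm : Measurable Ψ) (hΨi : Function.Involutive Ψ)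
    (hΨμ : MeasurePreserving Ψ ((volume : Measure (Fin (n + 1) → ℝ)).prod volume)
      ((volume : Measure (Fin (n + 1) → ℝ)).prod volume))
    {C : ℝ} {m : ℕ} (hC : 0 ≤ C) (hΨg : ∀ z, phaseSize (Ψ z) ≤ C * phaseSize z ^ m)
    (hs : Summable fun k => (∫ φ, ((∑ x, φ x) - gibbsExpect J lam (fun ψ => ∑ x, ψ x))
        * ((hmcOpOf J lam Ψ)^[k + 1]
            (fun ψ => (∑ x, ψ x) - gibbsExpect J lam (fun ψ => ∑ x, ψ x))) φ * gibbsWeight J lam φ)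
        / ∫ φ, ((∑ x, φ x) - gibbsExpect J lam (fun ψ => ∑ x, ψ x)) ^ 2 * gibbsWeight J lam φ) :
    gibbsExpect J lam (fun φ => |∑ x, φ x|) ^ 2
        / (gibbsExpect J lam (fun φ => ((∑ x, φ x) - gibbsExpect J lam (fun ψ => ∑ x, ψ x)) ^ 2)
          * (2 * ((∫ z, involAccept (phi4HmcEnergy J lam) Ψ z
            * (if (0 ≤ ∑ x, (Ψ z).1 x ↔ 0 ≤ ∑ x, z.1 x) then (0 : ℝ) else 1)
            * Real.exp (-phi4HmcEnergy J lam z) ∂((volume : Measure (Fin (n + 1) → ℝ)).prod volume))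
          / (momentumZ n * gibbsZ J lam)))) - 1 / 2
      ≤ tauInt (fun k => (∫ φ, ((∑ x, φ x) - gibbsExpect J lam (fun ψ => ∑ x, ψ x))
        * ((hmcOpOf J lam Ψ)^[k]
            (fun ψ => (∑ x, ψ x) - gibbsExpect J lam (fun ψ => ∑ x, ψ x))) φ * gibbsWeight J lam φ)
        / ∫ φ, ((∑ x, φ x) - gibbsExpect J lam (fun ψ => ∑ x, ψ x)) ^ 2 * gibbsWeight J lam φ) := by
  have hMm : Measurable fun φ : Fin (n + 1) → ℝ => ∑ y, φ y :=
    Finset.measurable_sum _ fun y _ => measurable_pi_apply y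
  set mM := gibbsExpect J lam (fun ψ : Fin (n + 1) → ℝ => ∑ x, ψ x) with hmM
  have h := hmc_tauInt_ge_cross hlam J hΨm hΨi hΨμ hC hΨg (polyObs_sub_const polyObs_magnetisation mM)
    hMm 0 hs
  rw [gibbsExpect_magnetisation_sub_mul_sign hlam J mM] at h
  exact h

/-- **ROW 2's HMC: THE MAGNETISATION INHERITS THE SIGN-FLIP FLOOR** (`hmcOpPhi4 J λ δ N`, every
`δ`, `N`): `τ_int,traj(M) ≥ ⟨|M|⟩² / (Var(M) · 2 r_sign) − ½`. -/
theorem hmcPhi4_tauInt_ge_magnetisation_signFlip {lam : ℝ} (hlam : 0 < lam)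
    (J : Fin (n + 1) → Fin (n + 1) → ℝ) (δ : ℝ) (N : ℕ)
    (hs : Summable fun k => (∫ φ, ((∑ x, φ x) - gibbsExpect J lam (fun ψ => ∑ x, ψ x))
        * ((hmcOpPhi4 J lam δ N)^[k + 1]
            (fun ψ => (∑ x, ψ x) - gibbsExpect J lam (fun ψ => ∑ x, ψ x))) φ * gibbsWeight J lam φ)
        / ∫ φ, ((∑ x, φ x) - gibbsExpect J lam (fun ψ => ∑ x, ψ x)) ^ 2 * gibbsWeight J lam φ) :
    gibbsExpect J lam (fun φ => |∑ x, φ x|) ^ 2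
        / (gibbsExpect J lam (fun φ => ((∑ x, φ x) - gibbsExpect J lam (fun ψ => ∑ x, ψ x)) ^ 2)
          * (2 * ((∫ z, involAccept (phi4HmcEnergy J lam) (hmcProposal J lam δ N) z
            * (if (0 ≤ ∑ x, (hmcProposal J lam δ N z).1 x ↔ 0 ≤ ∑ x, z.1 x) then (0 : ℝ) else 1)
            * Real.exp (-phi4HmcEnergy J lam z) ∂((volume : Measure (Fin (n + 1) → ℝ)).prod volume))
          / (momentumZ n * gibbsZ J lam)))) - 1 / 2
      ≤ tauInt (fun k => (∫ φ, ((∑ x, φ x) - gibbsExpect J lam (fun ψ => ∑ x, ψ x))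
        * ((hmcOpPhi4 J lam δ N)^[k]
            (fun ψ => (∑ x, ψ x) - gibbsExpect J lam (fun ψ => ∑ x, ψ x))) φ * gibbsWeight J lam φ)
        / ∫ φ, ((∑ x, φ x) - gibbsExpect J lam (fun ψ => ∑ x, ψ x)) ^ 2 * gibbsWeight J lam φ) := by
  obtain ⟨C, hC1, hCg⟩ := hmcProposal_growth J lam δ N
  exact hmc_tauInt_ge_magnetisation_signFlip hlam J (measurable_hmcProposal J lam δ N)
    (hmcProposal_involutive J lam δ N) (measurePreserving_hmcProposal J lam δ N)
    (zero_le_one.trans hC1) hCg hs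

end HMCMagnetisationTunnelling

end Summit.Ventures.LatticeQCDFlow.Exactness
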